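import Mathlib.Algebra.Order.Floor.Defs
import Literature.Barriers.PneNP.NaturalProofsTC0DDH
import Literature.Computability.Cryptography.NaorReingoldSecurity
import Literature.Computability.Cryptography.NaorReingoldFamilyTC0
import Literature.Computability.Cryptography.NaorReingoldTC0Size
import HarnessLib

/-!
# `HardPRFInTC0OfSubexpDDH` holds (proof file): Naor–Reingold's `TC⁰` pseudo-random functions
from subexponential DDH, discharged

Sibling proof file of `NaturalProofsTC0DDH.lean` (D-0014), DISCHARGING the named fact
`Literature.Barriers.PneNP.HardPRFInTC0OfSubexpDDH : SubexpDDH → HardPRFInTC0` (Naor–Reingold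
2004: under subexponentially hard DDH there is a keyed family in `TC⁰` whose truth tables are
superexponentially hard for `B₂`-circuits): `HardPRFInTC0OfSubexpDDH_holds`. The proof is
assembled from two halves:

* `hardPRFInTC0OfSubexpDDH_of_thm45` — the fact RELATIVE to NR's Thm. 4.5
  (`Literature.Computability.Cryptography.NaorReingold2004_thm45`: the bits of `f_{P,Q,g,ā}` have
  constant-depth polynomial-size threshold circuits). Everything in it — the non-uniform
  truth-table form of NR's Thm. 4.1 (hybrid argument with one DDH challenge per step, the
  simulator as an explicit `B₂`-circuit doing modular exponentiation), the hashing step of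
  Thm. 4.3 (inner-product family, coupling of i.i.d. biased bits), key sampling from bit strings,
  the growth bookkeeping of the Razborov–Rudich coupling `m = n^k`, and the `TC⁰` evaluation of
  the hash layer — is PROVED in
  `Literature/Computability/Cryptography/NaorReingold{Hybrids,Reduction,Ends,Family,Security,FamilyTC0}.lean`;
* `Literature.Computability.Cryptography.NaorReingold2004_thm45_holds` — Thm. 4.5 itself, PROVED in
  `Literature/Computability/Cryptography/NaorReingoldTC0Size.lean` (iterated multiplication in
  `TC⁰` by Chinese remaindering; `TCResidueLayer.lean`, `IteratedAdditionTC0.lean`).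

The family: at input length `n`, security parameter `m = n^k` with `k = ⌈2/δ⌉ + 2` (so `k ≥ 2`,
`kδ ≥ 2`), key = `n + 1` exponents of `2m` bits and an `m`-bit hash key,
`F n s x = ⟨r, bin((g^{a₀})^{∏_{xᵢ=1} aᵢ} mod P)⟩ mod 2` (`NaorReingold.Seq.family`).

Consequence: the p. 237 barrier "no natural proofs against `TC⁰` under subexponential DDH"
(`naturalProofsTC0_of_subexpDDH` of the same file, a theorem relative to the fact) in its
hypothesis-free form `naturalProofsTC0_of_subexpDDH'`, conditional only on `SubexpDDH`. The
route-facing hypothesis-free forms `no_natural_proof_of_not_mem_TC0_of_subexpDDH'` and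
`not_natural_useful_superset_TC0_of_subexpDDH'` live in the sibling
`NaturalProofsTC0DDHHolds.lean` (same namespace); they are not re-declared here, so that the two
modules stay jointly importable (`Literature.lean` imports both).

## References

* M. Naor, O. Reingold, *Number-theoretic constructions of efficient pseudo-random functions*,
  J. ACM 51 (2004), Thm. 4.1 (p. 245), Thm. 4.3 (p. 246), Thm. 4.5 (p. 252), p. 237.
* A. Razborov, S. Rudich, *Natural proofs*, JCSS 55 (1997), Thm. 4.1.
* S. Arora, B. Barak, *Computational Complexity: A Modern Approach* (2009), §23.3.
-/

noncomputable section

namespace Literature.Barriers.PneNP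

open Literature.Computability.Cryptography Literature.Computability.Cryptography.NaorReingold

/-- **`SubexpDDH → HardPRFInTC0`, given Naor–Reingold's Theorem 4.5.** From a `2^{m^δ}`-hard
instance sequence take `k = ⌈2/δ⌉ + 2` and the hashed Naor–Reingold family at security parameter
`m = n^k` (`NaorReingold.Seq.family`): it lies in `TC⁰` by Thm. 4.5 (`Seq.familyIn_TC0`) and its
truth-table generators are superexponentially hard (`Seq.superExpHard_family`, Thm. 4.1 + 4.3 in
truth-table form). [cite: NaorReingold2004, Thm. 4.1 (p. 245), Thm. 4.3 (p. 246), Thm. 4.5 (p. 252), p. 237] -/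
theorem hardPRFInTC0OfSubexpDDH_of_thm45 (h45 : NaorReingold2004_thm45) : HardPRFInTC0OfSubexpDDH := by
  rintro ⟨P, Q, g, δ, hδ, hhard⟩
  set k : ℕ := ⌈2 / δ⌉₊ + 2 with hk
  have hk2 : 2 ≤ k := by omega
  have hkδ : 2 ≤ (k : ℝ) * δ := by
    have h1 : 2 / δ ≤ ⌈2 / δ⌉₊ := Nat.le_ceil _
    have h2 : (k : ℝ) = ⌈2 / δ⌉₊ + 2 := by rw [hk]; push_cast; ring
    rw [h2]
    have h3 : 2 / δ * δ = 2 := div_mul_cancel₀ _ hδ.ne'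
    nlinarith
  let σ : Seq := ⟨P, Q, g, k⟩
  exact ⟨σ.keyLen, σ.family, σ.familyIn_TC0 h45 (show 1 ≤ k by omega), σ.superExpHard_family hk2 hkδ hhard⟩

/-! ### Discharge -/

/-- **Discharge of `HardPRFInTC0OfSubexpDDH` (Naor–Reingold 2004, Thms. 4.1, 4.3, 4.5 with the
Razborov–Rudich coupling)**: if the decisional Diffie–Hellman assumption holds against
subexponential-size circuits for some instance sequence, then there is a keyed family of Boolean
functions in non-uniform `TC⁰` whose truth-table generators are superexponentially hard.
[cite: NaorReingold2004, Thm. 4.1 (p. 245), Thm. 4.3 (p. 246), Thm. 4.5 (p. 252), p. 237] -/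
theorem HardPRFInTC0OfSubexpDDH_holds : HardPRFInTC0OfSubexpDDH :=
  hardPRFInTC0OfSubexpDDH_of_thm45 NaorReingold2004_thm45_holds

/-- **The p. 237 barrier, hypothesis-free in the fact**: under subexponential DDH there is no
`P/poly`-natural property useful against `TC⁰` ("no Natural Proofs for separating `TC⁰` from
P/poly", p. 237). [cite: NaorReingold2004, p. 237] -/
theorem naturalProofsTC0_of_subexpDDH' (hd : SubexpDDH) :
    ¬ ∃ P : Literature.Computability.MetaComplexity.CombinatorialProperty,
      Literature.Computability.MetaComplexity.IsNatural Literature.Computability.Complexity.PPoly P ∧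
      Literature.Computability.MetaComplexity.IsUsefulAgainst Literature.Computability.Complexity.TC0 P :=
  naturalProofsTC0_of_subexpDDH HardPRFInTC0OfSubexpDDH_holds hd

end Literature.Barriers.PneNP

end
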